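import Summits.ValiantsHypothesis.ValiantsHypothesis.Theorems.BarrierLeverPartitionMinorsChowLeafStep

/-!
# Route BarrierLever — Chow witnesses for partition minors (items 20172 / 20195): the EDGE STEP —
# an edge of the rows against an edge of the columns, classes of ANY size

Helper file (`--supports stmt-ValiantsHypothesis-20172`; cell valiant-natproofs, rung V4, 𝒟-side of
door (c); seat val-np-p4 gen 13).  Closes NO item.  Conventions of items 19717 / 20172 / 20195: a
layout `(u, w)` of height `h` (`u w : Fin r → Finset (Fin h)`) is HIT when some product of `h + h`
affine forms has nonsingular partition minor `det[coeff_{E (u i) (w j)} ∏ ℓ]`.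

**The edge step (`chow_edgeStep`).**  Let `(u, w)` be a layout of height `h + 1` and size `r + 1`
with an EDGE on each side: rows `u i₁ = u i₀ ∪ {a}` (`u i₀ = (u i₁).erase a`, `a ∈ u i₁`) and columns
`w j₁ = w j₀ ∪ {c}`.  NO condition on the sizes of the literal classes of `a` or `c` (the leaf step
of `…ChowLeafStep` needed `a` lonely; the split needs equal class sizes; the peel needs injective
erasures on both sides).  If the REDUCED layout of height `h` and size `r` — drop row `i₁` and column
`j₁`, delete `a` from the rows and `c` from the columns, pull back along `a.succAbove` /
`c.succAbove` — is hit, then `(u, w)` is hit.  (When `a` and `c` each carry EXACTLY ONE edge the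
reduced layout is again injective — the engine's bookkeeping, not the step's.)

Proof.  One product `∏ ℓ` of `h + h` forms hits the reduced layout and the `1 × 1` layout
`(u i₀, w j₀)` (`exists_common_chow_witness₂`); lift it along `(a, c)` and multiply by the
ONE-PARAMETER gadget `g_t = (1 + x_a + (1 - t) y_c)(1 + t y_c)` with multilinear coefficients
`1, 1, 1, t` at `(∅,∅), ({a},∅), (∅,{c}), ({a},{c})` (`coeff_edgeGadget`).  The partition matrix is
then `M(t) i j = t^{[a ∈ u i][c ∈ w j]} · F i j` (`coeff_partitionExpo_mul_pairFactor`), where `F`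
(the lifted witness's coefficients at `((u i) \ a, (w j) \ c)`) has equal rows `i₁, i₀` and equal
columns `j₁, j₀`.  Over `ℂ[X]`: subtracting row `i₀` from row `i₁` leaves `(X - 1)·(masked row)`, so
`det M(X) = (X - 1) · D(X)` (`det_edgeMatrix_eq`), and `D(1) = ± F i₁ j₁ · det(reduced minor)`
(`det_updateRow_masked`: subtract column `j₀` from column `j₁`, Laplace).  Both factors of `D(1)` are
nonzero, so `D ≠ 0` has finitely many roots and some `t ≠ 1` gives `det M(t) = (t - 1) D(t) ≠ 0`
(`exists_det_edge_ne_zero`, `Infinite.exists_notMem_finset`).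

WHAT THIS IS NOT: a reduction step (hits nothing by itself; the engine corollary is a separate file);
nothing on items 20172 / 20195 / 19717 themselves, on crux stmt-ValiantsHypothesis-14610, or on `VP`
versus `VNP`.
-/

set_option linter.dupNamespace false

namespace Summit.ValiantsHypothesis.ValiantsHypothesis.Theorems.BarrierLever.ChowFactor

open Finset MvPolynomial

noncomputable section

variable {h : ℕ}

/-! ## 1. Determinant algebra: an edge against an edge -/

/-- **Row edge ⇒ a factor `X - 1`.**  For the deformation `P i j = F i j · X^{[β i ∧ γ j]}` of a
matrix `F` whose rows `v₁` (with `β`) and `v₀` (without `β`) coincide: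
`det P = (X - 1) · det (P with row v₁ replaced by the γ-masked row v₁ of F)`. -/
theorem det_edgeMatrix_eq {n : ℕ} (F : Matrix (Fin (n + 1)) (Fin (n + 1)) ℂ)
    (β γ : Fin (n + 1) → Prop) [DecidablePred β] [DecidablePred γ] (v₁ v₀ : Fin (n + 1))
    (hv : v₁ ≠ v₀) (hβ₁ : β v₁) (hβ₀ : ¬ β v₀) (hrow : ∀ j, F v₁ j = F v₀ j) :
    (Matrix.of fun i j => Polynomial.C (F i j) *
        (if β i ∧ γ j then (Polynomial.X : Polynomial ℂ) else 1)).det =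
      (Polynomial.X - 1) *
        ((Matrix.of fun i j => Polynomial.C (F i j) *
            (if β i ∧ γ j then (Polynomial.X : Polynomial ℂ) else 1)).updateRow v₁
          (fun j => if γ j then Polynomial.C (F v₁ j) else 0)).det := by
  classical
  set P : Matrix (Fin (n + 1)) (Fin (n + 1)) (Polynomial ℂ) := Matrix.of fun i j =>
    Polynomial.C (F i j) * (if β i ∧ γ j then (Polynomial.X : Polynomial ℂ) else 1) with hP
  have hop := Matrix.det_updateRow_add_smul_self P hv (-1)
  have hrow' : P v₁ + (-1 : Polynomial ℂ) • P v₀ =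
      ((Polynomial.X : Polynomial ℂ) - 1) • (fun j => if γ j then Polynomial.C (F v₁ j) else 0) := by
    ext j
    simp only [Pi.add_apply, Pi.smul_apply, smul_eq_mul, hP, Matrix.of_apply, hβ₁, hβ₀, true_and,
      false_and, if_false, hrow j]
    by_cases hγ : γ j
    · rw [if_pos hγ, if_pos hγ]; ring
    · rw [if_neg hγ, if_neg hγ]; ring
  rw [hrow', Matrix.det_updateRow_smul] at hop
  exact hop.symm

/-- **Column edge ⇒ Laplace.**  If the columns `j₁` (with `γ`) and `j₀` (without `γ`) of `F`
coincide, then `F` with row `v₁` replaced by its `γ`-masked row has determinant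
`(-1)^{v₁ + j₁} · F v₁ j₁ · det (F off row v₁ and column j₁)`. -/
theorem det_updateRow_masked {n : ℕ} (F : Matrix (Fin (n + 1)) (Fin (n + 1)) ℂ)
    (γ : Fin (n + 1) → Prop) [DecidablePred γ] (v₁ j₁ j₀ : Fin (n + 1)) (hj : j₁ ≠ j₀)
    (hγ₁ : γ j₁) (hγ₀ : ¬ γ j₀) (hcol : ∀ i, F i j₁ = F i j₀) :
    (F.updateRow v₁ (fun j => if γ j then F v₁ j else 0)).det =
      (-1) ^ ((v₁ : ℕ) + (j₁ : ℕ)) * F v₁ j₁ * (F.submatrix v₁.succAbove j₁.succAbove).det := by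
  classical
  set N : Matrix (Fin (n + 1)) (Fin (n + 1)) ℂ :=
    F.updateRow v₁ (fun j => if γ j then F v₁ j else 0) with hN
  have hop := Matrix.det_updateCol_add_smul_self N hj (-1)
  -- the new column vanishes off `v₁` and is `F v₁ j₁` at `v₁`
  have hcol0 : ∀ i, i ≠ v₁ → N i j₁ + (-1 : ℂ) • N i j₀ = 0 := by
    intro i hi
    simp only [hN, Matrix.updateRow_ne hi, smul_eq_mul, hcol i]
    ring
  have hcol1 : N v₁ j₁ + (-1 : ℂ) • N v₁ j₀ = F v₁ j₁ := by
    simp only [hN, Matrix.updateRow_self, if_pos hγ₁, if_neg hγ₀, smul_eq_mul]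
    ring
  have hlap := Matrix.det_succ_column (N.updateCol j₁ fun k => N k j₁ + (-1 : ℂ) • N k j₀) j₁
  rw [Finset.sum_eq_single v₁] at hlap
  · have hsub : (N.updateCol j₁ fun k => N k j₁ + (-1 : ℂ) • N k j₀).submatrix
        v₁.succAbove j₁.succAbove = F.submatrix v₁.succAbove j₁.succAbove := by
      ext k l
      rw [Matrix.submatrix_apply, Matrix.updateCol_ne (Fin.succAbove_ne j₁ l), hN,
        Matrix.updateRow_ne (Fin.succAbove_ne v₁ k), Matrix.submatrix_apply]
    rw [hsub, Matrix.updateCol_self, hcol1, hop] at hlap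
    exact hlap
  · intro i _ hi
    rw [Matrix.updateCol_self, hcol0 i hi, mul_zero, zero_mul]
  · intro hi
    exact absurd (Finset.mem_univ v₁) hi

/-- **Edge against edge: some parameter works.**  If the rows `v₁ ∋ β`, `v₀ ∌ β` of `F` coincide, the
columns `j₁ ∋ γ`, `j₀ ∌ γ` coincide, `F v₁ j₁ ≠ 0` and the minor off `(v₁, j₁)` is nonsingular, then
for some `t` the matrix `t^{[β i ∧ γ j]} · F i j` is nonsingular. -/
theorem exists_det_edge_ne_zero {n : ℕ} (F : Matrix (Fin (n + 1)) (Fin (n + 1)) ℂ)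
    (β γ : Fin (n + 1) → Prop) [DecidablePred β] [DecidablePred γ] (v₁ v₀ j₁ j₀ : Fin (n + 1))
    (hv : v₁ ≠ v₀) (hβ₁ : β v₁) (hβ₀ : ¬ β v₀) (hrow : ∀ j, F v₁ j = F v₀ j)
    (hj : j₁ ≠ j₀) (hγ₁ : γ j₁) (hγ₀ : ¬ γ j₀) (hcol : ∀ i, F i j₁ = F i j₀)
    (hent : F v₁ j₁ ≠ 0) (hminor : (F.submatrix v₁.succAbove j₁.succAbove).det ≠ 0) :
    ∃ t : ℂ, (Matrix.of fun i j => (if β i ∧ γ j then t else 1) * F i j).det ≠ 0 := by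
  classical
  set P : Matrix (Fin (n + 1)) (Fin (n + 1)) (Polynomial ℂ) := Matrix.of fun i j =>
    Polynomial.C (F i j) * (if β i ∧ γ j then (Polynomial.X : Polynomial ℂ) else 1) with hP
  set D : Polynomial ℂ :=
    (P.updateRow v₁ (fun j => if γ j then Polynomial.C (F v₁ j) else 0)).det with hD
  have hfac : P.det = (Polynomial.X - 1) * D := det_edgeMatrix_eq F β γ v₁ v₀ hv hβ₁ hβ₀ hrow
  -- evaluation of the deformation at `t`
  have heval : ∀ t : ℂ, (Polynomial.evalRingHom t).mapMatrix P =
      Matrix.of fun i j => (if β i ∧ γ j then t else 1) * F i j := by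
    intro t
    ext i j
    simp only [RingHom.mapMatrix_apply, Matrix.map_apply, hP, Matrix.of_apply,
      Polynomial.coe_evalRingHom, Polynomial.eval_mul, Polynomial.eval_C]
    split_ifs <;> simp [mul_comm]
  -- `D(1) ≠ 0`
  have hD1 : Polynomial.eval 1 D ≠ 0 := by
    have e : (Polynomial.evalRingHom (1 : ℂ)).mapMatrix
        (P.updateRow v₁ (fun j => if γ j then Polynomial.C (F v₁ j) else 0)) =
        F.updateRow v₁ (fun j => if γ j then F v₁ j else 0) := by
      ext i j
      by_cases hi : i = v₁
      · subst hi
        simp only [RingHom.mapMatrix_apply, Matrix.map_apply, Matrix.updateRow_self,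
          Polynomial.coe_evalRingHom]
        split_ifs <;> simp
      · simp only [RingHom.mapMatrix_apply, Matrix.map_apply, Matrix.updateRow_ne hi, hP,
          Matrix.of_apply, Polynomial.coe_evalRingHom, Polynomial.eval_mul, Polynomial.eval_C]
        split_ifs <;> simp
    have e2 : Polynomial.eval 1 D = (F.updateRow v₁ (fun j => if γ j then F v₁ j else 0)).det := by
      rw [hD, ← Polynomial.coe_evalRingHom, RingHom.map_det, e]
    rw [e2, det_updateRow_masked F γ v₁ j₁ j₀ hj hγ₁ hγ₀ hcol]
    exact mul_ne_zero (mul_ne_zero (pow_ne_zero _ (by norm_num)) hent) hminor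
  have hD0 : D ≠ 0 := fun h0 => hD1 (by rw [h0, Polynomial.eval_zero])
  -- avoid `1` and the roots of `D`
  obtain ⟨t, ht⟩ := Infinite.exists_notMem_finset (insert (1 : ℂ) D.roots.toFinset)
  rw [Finset.mem_insert, not_or, Multiset.mem_toFinset, Polynomial.mem_roots hD0] at ht
  refine ⟨t, ?_⟩
  rw [← heval t, ← RingHom.map_det, hfac, Polynomial.coe_evalRingHom, Polynomial.eval_mul,
    Polynomial.eval_sub, Polynomial.eval_X, Polynomial.eval_one]
  exact mul_ne_zero (sub_ne_zero.mpr ht.1) ht.2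

/-! ## 2. The one-parameter gadget `g_t = (1 + x_a + (1 - t) y_c)(1 + t y_c)` -/

/-- The gadget involves only `x_a` and `y_c`. -/
theorem support_edgeGadget (a c : Fin (h + 1)) (t : ℂ) :
    ∀ m ∈ ((C 1 + C 1 * X (Fin.castAdd (h + 1) a) + C (1 - t) * X (Fin.natAdd (h + 1) c)) *
        (C 1 + C 0 * X (Fin.castAdd (h + 1) a) + C t * X (Fin.natAdd (h + 1) c)) :
        MvPolynomial (Fin ((h + 1) + (h + 1))) ℂ).support,
      ∀ v, ¬ (v = Fin.castAdd (h + 1) a ∨ v = Fin.natAdd (h + 1) c) → m v = 0 := by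
  classical
  intro m hm v hv
  by_contra hne
  have hvars : v ∈ ((C 1 + C 1 * X (Fin.castAdd (h + 1) a) + C (1 - t) * X (Fin.natAdd (h + 1) c)) *
      (C 1 + C 0 * X (Fin.castAdd (h + 1) a) + C t * X (Fin.natAdd (h + 1) c)) :
      MvPolynomial (Fin ((h + 1) + (h + 1))) ℂ).vars :=
    (mem_vars_iff_mem_support v).mpr ⟨m, hm, Finsupp.mem_support_iff.mpr hne⟩
  have hv' := (vars_mul _ _).trans
    (Finset.union_subset (vars_affine_xy_subset a c 1 (1 - t)) (vars_affine_xy_subset a c 0 t)) hvars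
  simp only [Finset.mem_insert, Finset.mem_singleton] at hv'
  exact hv hv'

/-- **The four multilinear coefficients of the gadget** `g_t`: `1` at `(∅, ∅)`, `({a}, ∅)`,
`(∅, {c})` and `t` at `({a}, {c})`. -/
theorem coeff_edgeGadget (a c : Fin (h + 1)) (t : ℂ) (U W : Finset (Fin (h + 1)))
    (hU : U = ∅ ∨ U = {a}) (hW : W = ∅ ∨ W = {c}) :
    coeff (∑ a' ∈ U, Finsupp.single (Fin.castAdd (h + 1) a') 1 +
        ∑ c' ∈ W, Finsupp.single (Fin.natAdd (h + 1) c') 1)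
      ((C 1 + C 1 * X (Fin.castAdd (h + 1) a) + C (1 - t) * X (Fin.natAdd (h + 1) c)) *
        (C 1 + C 0 * X (Fin.castAdd (h + 1) a) + C t * X (Fin.natAdd (h + 1) c)) :
        MvPolynomial (Fin ((h + 1) + (h + 1))) ℂ) =
      if U = {a} ∧ W = {c} then t else 1 := by
  classical
  rw [← affine_xy_eq a c 0 t, coeff_partitionExpo_mul_affine, ← affine_xy_eq a c 1 (1 - t),
    coeff_partitionExpo_affine]
  simp_rw [coeff_partitionExpo_affine]
  have hane : ({a} : Finset (Fin (h + 1))) ≠ ∅ := Finset.singleton_ne_empty a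
  have hcne : ({c} : Finset (Fin (h + 1))) ≠ ∅ := Finset.singleton_ne_empty c
  rcases hU with rfl | rfl <;> rcases hW with rfl | rfl
  all_goals simp [hane, hcne, Finset.sum_singleton]

/-! ## 3. The edge step -/

/-- **THE EDGE STEP for Chow witnesses.**  Height `h + 1`, size `r + 1`; the rows carry the edge
`u i₁ = u i₀ ∪ {a}` (`i₁ ≠ i₀`, `a ∈ u i₁`, `u i₀ = (u i₁).erase a`) and the columns the edge
`w j₁ = w j₀ ∪ {c}` — the sizes of the literal classes of `a` and `c` are arbitrary.  If the reduced
layout — rows `i ≠ i₁` and columns `j ≠ j₁` (listed along `i₁.succAbove`, `j₁.succAbove`), with `a`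
deleted from the rows and `c` from the columns and pulled back to height `h` — is hit by a product of
`h + h` affine forms, then `(u, w)` is hit by a product of `(h+1) + (h+1)` affine forms. -/
theorem chow_edgeStep (a c : Fin (h + 1)) {r : ℕ} (u w : Fin (r + 1) → Finset (Fin (h + 1)))
    (i₁ i₀ j₁ j₀ : Fin (r + 1)) (hi : i₁ ≠ i₀) (ha : a ∈ u i₁) (hi₀ : u i₀ = (u i₁).erase a)
    (hj : j₁ ≠ j₀) (hc : c ∈ w j₁) (hj₀ : w j₀ = (w j₁).erase c)
    (hred : ∃ ℓ : Fin (h + h) → MvPolynomial (Fin (h + h)) ℂ, (∀ q, (ℓ q).totalDegree ≤ 1) ∧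
      (Matrix.of fun k l : Fin r => coeff
        (∑ b ∈ (u (i₁.succAbove k)).preimage a.succAbove Fin.succAbove_right_injective.injOn,
            Finsupp.single (Fin.castAdd h b) 1 +
          ∑ d ∈ (w (j₁.succAbove l)).preimage c.succAbove Fin.succAbove_right_injective.injOn,
            Finsupp.single (Fin.natAdd h d) 1)
        (∏ q, ℓ q)).det ≠ 0) :
    ∃ ℓ : Fin ((h + 1) + (h + 1)) → MvPolynomial (Fin ((h + 1) + (h + 1))) ℂ,
      (∀ q, (ℓ q).totalDegree ≤ 1) ∧
      (Matrix.of fun i j : Fin (r + 1) => coeff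
        (∑ a' ∈ u i, Finsupp.single (Fin.castAdd (h + 1) a') 1 +
          ∑ c' ∈ w j, Finsupp.single (Fin.natAdd (h + 1) c') 1)
        (∏ q, ℓ q)).det ≠ 0 := by
  classical
  -- the `1 × 1` layout `(u i₁ \ a, w j₁ \ c)` is hit
  have hone : ∃ ℓ : Fin (h + h) → MvPolynomial (Fin (h + h)) ℂ, (∀ q, (ℓ q).totalDegree ≤ 1) ∧
      (Matrix.of fun _ _ : Fin 1 => coeff
        (∑ b ∈ (u i₁).preimage a.succAbove Fin.succAbove_right_injective.injOn,
            Finsupp.single (Fin.castAdd h b) 1 +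
          ∑ d ∈ (w j₁).preimage c.succAbove Fin.succAbove_right_injective.injOn,
            Finsupp.single (Fin.natAdd h d) 1)
        (∏ q, ℓ q)).det ≠ 0 :=
    chowHits_of_size_le_three h 1 (by norm_num) _ _ (Function.injective_of_subsingleton _)
      (Function.injective_of_subsingleton _)
  obtain ⟨ℓ, hdeg, hA, hD⟩ := exists_common_chow_witness₂ _ _ _ _ hred hone
  rw [Matrix.det_fin_one, Matrix.of_apply] at hD
  -- the coefficient matrix of the (future) lifted witness and its doubled row / column
  set F : Matrix (Fin (r + 1)) (Fin (r + 1)) ℂ := Matrix.of fun i j => coeff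
      (∑ b ∈ (u i).preimage a.succAbove Fin.succAbove_right_injective.injOn,
          Finsupp.single (Fin.castAdd h b) 1 +
        ∑ d ∈ (w j).preimage c.succAbove Fin.succAbove_right_injective.injOn,
          Finsupp.single (Fin.natAdd h d) 1) (∏ q, ℓ q) with hFdef
  have ha₀ : a ∉ u i₀ := by rw [hi₀]; exact Finset.notMem_erase a _
  have hc₀ : c ∉ w j₀ := by rw [hj₀]; exact Finset.notMem_erase c _
  have hFrow : ∀ j, F i₁ j = F i₀ j := by
    intro j
    rw [hFdef, Matrix.of_apply, Matrix.of_apply, hi₀, preimage_succAbove_erase]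
  have hFcol : ∀ i, F i j₁ = F i j₀ := by
    intro i
    rw [hFdef, Matrix.of_apply, Matrix.of_apply, hj₀, preimage_succAbove_erase]
  have hminor : (F.submatrix i₁.succAbove j₁.succAbove).det ≠ 0 := by
    have hsub : F.submatrix i₁.succAbove j₁.succAbove = Matrix.of fun k l : Fin r => coeff
        (∑ b ∈ (u (i₁.succAbove k)).preimage a.succAbove Fin.succAbove_right_injective.injOn,
            Finsupp.single (Fin.castAdd h b) 1 +
          ∑ d ∈ (w (j₁.succAbove l)).preimage c.succAbove Fin.succAbove_right_injective.injOn,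
            Finsupp.single (Fin.natAdd h d) 1) (∏ q, ℓ q) := by
      ext k l
      rw [Matrix.submatrix_apply, hFdef, Matrix.of_apply, Matrix.of_apply]
    rw [hsub]
    exact hA
  have hent : F i₁ j₁ ≠ 0 := by rw [hFdef, Matrix.of_apply]; exact hD
  -- the parameter
  obtain ⟨t, ht⟩ := exists_det_edge_ne_zero F (fun i => a ∈ u i) (fun j => c ∈ w j) i₁ i₀ j₁ j₀
    hi ha ha₀ hFrow hj hc hc₀ hFcol hent hminor
  -- the lift and the gadget
  set L : Fin (h + h) → Fin ((h + 1) + (h + 1)) := Fin.append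
    (fun b : Fin h => Fin.castAdd (h + 1) (a.succAbove b))
    (fun d : Fin h => Fin.natAdd (h + 1) (c.succAbove d)) with hL
  set f₁ : MvPolynomial (Fin ((h + 1) + (h + 1))) ℂ :=
    C 1 + C 1 * X (Fin.castAdd (h + 1) a) + C (1 - t) * X (Fin.natAdd (h + 1) c) with hf₁
  set f₂ : MvPolynomial (Fin ((h + 1) + (h + 1))) ℂ :=
    C 1 + C 0 * X (Fin.castAdd (h + 1) a) + C t * X (Fin.natAdd (h + 1) c) with hf₂
  have hcard : (h + h) + 2 = (h + 1) + (h + 1) := by omega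
  set e : Fin ((h + h) + 2) ≃ Fin ((h + 1) + (h + 1)) := finCongr hcard with he
  set ℓ' : Fin ((h + h) + 2) → MvPolynomial (Fin ((h + 1) + (h + 1))) ℂ :=
    Fin.append (fun q => rename L (ℓ q)) ![f₁, f₂] with hℓ'
  refine ⟨fun q => ℓ' (e.symm q), fun q => ?_, ?_⟩
  · show (ℓ' (e.symm q)).totalDegree ≤ 1
    generalize e.symm q = q₀
    rw [hℓ']
    induction q₀ using Fin.addCases with
    | left q' =>
      rw [Fin.append_left]
      exact totalDegree_rename_le_one L (ℓ q') (hdeg q')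
    | right q' =>
      rw [Fin.append_right]
      fin_cases q'
      · exact totalDegree_affine_xy_le a c 1 (1 - t)
      · exact totalDegree_affine_xy_le a c 0 t
  · -- the product
    have hprod : (∏ q, ℓ' (e.symm q)) = (f₁ * f₂) * rename L (∏ q, ℓ q) := by
      rw [Fintype.prod_equiv e.symm (fun q => ℓ' (e.symm q)) ℓ' (fun _ => rfl), hℓ',
        Fin.prod_univ_add]
      simp only [Fin.append_left, Fin.append_right, Fin.prod_univ_two, Matrix.cons_val_zero,
        Matrix.cons_val_one]
      rw [map_prod, mul_comm]
    rw [hprod]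
    -- entries of the partition matrix: gadget coefficient × lifted coefficient
    have hentry : ∀ i j : Fin (r + 1), coeff
        (∑ a' ∈ u i, Finsupp.single (Fin.castAdd (h + 1) a') 1 +
          ∑ c' ∈ w j, Finsupp.single (Fin.natAdd (h + 1) c') 1) ((f₁ * f₂) * rename L (∏ q, ℓ q)) =
        (if a ∈ u i ∧ c ∈ w j then t else 1) * F i j := by
      intro i j
      rw [coeff_partitionExpo_mul_pairFactor _ _ a c (support_edgeGadget a c t)
        (support_rename_lift a c _) (u i) (w j)]
      have hfa : (u i).filter (fun a' => a' = a) = u i ∩ {a} := by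
        ext x; simp [Finset.mem_filter, Finset.mem_inter]
      have hfc : (w j).filter (fun c' => c' = c) = w j ∩ {c} := by
        ext x; simp [Finset.mem_filter, Finset.mem_inter]
      rw [hfa, hfc, coeff_edgeGadget a c t _ _ ?_ ?_, erase_eq_map_preimage_succAbove,
        erase_eq_map_preimage_succAbove, coeff_lift_rename, hFdef, Matrix.of_apply]
      · have hane : ({a} : Finset (Fin (h + 1))) ≠ ∅ := Finset.singleton_ne_empty a
        have hcne : ({c} : Finset (Fin (h + 1))) ≠ ∅ := Finset.singleton_ne_empty c
        by_cases ha' : a ∈ u i <;> by_cases hc' : c ∈ w j <;>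
          simp [Finset.inter_singleton_of_mem, Finset.inter_singleton_of_notMem, ha', hc',
            hane.symm, hcne.symm]
      · by_cases ha' : a ∈ u i
        · right; rw [Finset.inter_singleton_of_mem ha']
        · left; rw [Finset.inter_singleton_of_notMem ha']
      · by_cases hc' : c ∈ w j
        · right; rw [Finset.inter_singleton_of_mem hc']
        · left; rw [Finset.inter_singleton_of_notMem hc']
    have hM : (Matrix.of fun i j : Fin (r + 1) => coeff
        (∑ a' ∈ u i, Finsupp.single (Fin.castAdd (h + 1) a') 1 +
          ∑ c' ∈ w j, Finsupp.single (Fin.natAdd (h + 1) c') 1) ((f₁ * f₂) * rename L (∏ q, ℓ q))) =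
        Matrix.of fun i j => (if a ∈ u i ∧ c ∈ w j then t else 1) * F i j := by
      ext i j
      rw [Matrix.of_apply, hentry, Matrix.of_apply]
    rw [hM]
    exact ht

end

end Summit.ValiantsHypothesis.ValiantsHypothesis.Theorems.BarrierLever.ChowFactor
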